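import Summits.ValiantsHypothesis.ValiantsHypothesis.Theorems.GrenetZeonDualUnipotentThreeHalvesLongMassFreeTriangularCert
import Summits.ValiantsHypothesis.ValiantsHypothesis.Theorems.GrenetZeonDualUnipotentThreeHalvesLongMassSubmodule

/-!
# `GrenetZeon.DualUnipotentThreeHalves` (stmt-ValiantsHypothesis-24318), line `slow_core`, stub (c) `SlowCore.LongMassSlowLawInv`:
# the two-sided price of `𝔫_b` IN THE SUBMODULE CURRENCY of ✓ `longMassSlowLawInv_iff_submodule`

✓ `…LongMassFreeTriangularPrice` / ✓ `…LongMassFreeTriangularCert` price the free triangular PENCIL.  The cell's currency of record for (c) is the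
coordinate-free one (✓ p840930 `longMassSlowLawInv_iff_submodule`, rules ✓ `price_mono_submodule` / `price_conj_submodule` / `price_transpose_submodule`):
a nilpotent `V ≤ M_b(ℂ)` is priced by pairs `(W ≤ V, k)` with the WINDOW property (entries of `(A + s w)^p`, `A ∈ V`, `w ∈ W`, `p ≤ n − 1`, of `s`-degree
`≤ k`) at cost `n·k + (dim V − dim W)`.  This file moves both bounds to that currency for `V = 𝔫_b` = the strictly upper triangular matrices
(given as ANY submodule `V` with `A ∈ V ↔ ∀ i j, ¬ i < j → A i j = 0`; `b ≤ n`):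

* ★★★ `two_mul_sq_le_of_window_strictUpper` — every window pair `(W, k)` of `𝔫_b` has `(n·k + (dim 𝔫_b − dim W) + n + 2b)² ≥ 2·n·b²`;
* ★★★ `exists_window_strictUpper_blocks` — for every `k` there is a window pair `(W, k)` of `𝔫_b` with
  `n·k + (dim 𝔫_b − dim W) ≤ n·k + (k+1)·C(⌈b/(k+1)⌉, 2)`.

By ✓ `price_conj_submodule` the same two-sided price holds for EVERY maximal-dimension nilpotent space `g 𝔫_b g⁻¹` (the full flag algebras), and by
✓ `price_mono_submodule` the lower bound passes to no proper enlargement (there is none: `𝔫_b` is inclusion-maximal) while the upper bound passes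
to every sub-space of a flag algebra — the triangularisable rows of the cell are priced at `≤ √2·√n·b + O(n + b)`, improving the band constant `2`.

HONEST FRAMING.  Currency transfer / calibration (`--supports stmt-ValiantsHypothesis-24318`); (c) `LongMassSlowLawInv` (∃ c) is RESEARCH — OPEN;
closes no stub; S3, 24318, 8062 (`stub_dualUnipotent`) and `VP ≠ VNP` are NOT proved.  Def-free, no named facts, no sorry.
-/

set_option linter.dupNamespace false
set_option autoImplicit false

noncomputable section

namespace Summit.ValiantsHypothesis.ValiantsHypothesis.Theorems.GrenetZeon.FreeTriangularPrice

open MvPolynomial Matrix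
open scoped BigOperators
open Summit.ValiantsHypothesis.ValiantsHypothesis.Cruxes.TwoDimCoefficients.DimTwoCases (AffMat IsAffine)
open Summit.ValiantsHypothesis.ValiantsHypothesis.Theorems.GrenetZeon.RadicalSplit (lineSubst)
open Summit.ValiantsHypothesis.ValiantsHypothesis.Theorems.GrenetZeon.SlowCore (linEntry Ledger RelCert)
open Summit.ValiantsHypothesis.ValiantsHypothesis.Theorems.GrenetZeon.ResolventFlag (pointMat linMat)
open Summit.ValiantsHypothesis.ValiantsHypothesis.Theorems.GrenetZeon.LedgerIndex (exists_linearMap_linMat codim_map_le_codim)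
open Summit.ValiantsHypothesis.ValiantsHypothesis.Theorems.GrenetZeon.LongMassHomogenise (map_lineSubst_eq_add_smul codim_comap_eq)

variable {n b : ℕ}

/-- The standard free triangular pencil on the first `b ≤ n` indices: linear (no constant terms), and its value space is EXACTLY the strictly upper
triangular matrices (every strictly upper `A` is a linear part). -/
theorem free_std_spec (hbn : b ≤ n) (N : AffMat n b)
    (hN : ∀ i j, N i j = if i < j then X (Fin.castLE hbn i, Fin.castLE hbn j) else 0) :
    (∀ i j, coeff 0 (N i j) = 0) ∧
    (∀ A : Matrix (Fin b) (Fin b) ℂ, (∀ i j, ¬ i < j → A i j = 0) → ∃ v, linMat N v = A) := by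
  classical
  refine ⟨fun i j => ?_, fun A hA => ?_⟩
  · rw [hN]; split_ifs
    · exact coeff_zero_X _
    · exact coeff_zero _
  · refine ⟨fun c => if h : (c.1 : ℕ) < b ∧ (c.2 : ℕ) < b then A ⟨c.1, h.1⟩ ⟨c.2, h.2⟩ else 0, ?_⟩
    ext i j
    rw [linMat_free (Fin.castLE hbn) N hN]
    by_cases hij : i < j
    · rw [if_pos hij, dif_pos ⟨by simp [i.2], by simp [j.2]⟩]
      congr 1
    · rw [if_neg hij, hA i j hij]

/-- ★★★ **LOWER BOUND, SUBMODULE CURRENCY.**  Let `V ≤ M_b(ℂ)` be the strictly upper triangular matrices (`b ≤ n`).  Every window pair `(W, k)` of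
`V` costs `P = n·k + (dim V − dim W)` with `(P + n + 2b)² ≥ 2·n·b²`. -/
theorem two_mul_sq_le_of_window_strictUpper (hbn : b ≤ n) (V : Submodule ℂ (Matrix (Fin b) (Fin b) ℂ))
    (hV : ∀ A : Matrix (Fin b) (Fin b) ℂ, A ∈ V ↔ ∀ i j, ¬ i < j → A i j = 0)
    (W : Submodule ℂ (Matrix (Fin b) (Fin b) ℂ)) (k : ℕ) (hWV : W ≤ V)
    (hwin : ∀ A ∈ V, ∀ w ∈ W, ∀ p : ℕ, p ≤ n - 1 → ∀ i j : Fin b,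
      (((A.map (C : ℂ → MvPolynomial (Fin 1) ℂ) + (X 0 : MvPolynomial (Fin 1) ℂ) • w.map C) ^ p :
        Matrix (Fin b) (Fin b) (MvPolynomial (Fin 1) ℂ)) i j).totalDegree ≤ k) :
    2 * n * (b * b) ≤ (n * k + (Module.finrank ℂ V - Module.finrank ℂ W) + n + 2 * b) ^ 2 := by
  classical
  set ι : Fin b → Fin n := Fin.castLE hbn with hι
  have hιinj : Function.Injective ι := Fin.castLE_injective hbn
  set N : AffMat n b := Matrix.of fun i j => if i < j then X (ι i, ι j) else 0 with hNdef
  have hN : ∀ i j, N i j = if i < j then X (ι i, ι j) else 0 := fun i j => rfl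
  obtain ⟨h0, hsurj⟩ := free_std_spec hbn N hN
  have haff := isAffine_free ι N hN
  obtain ⟨T, hT⟩ := exists_linearMap_linMat N
  have hrange : LinearMap.range T = V := by
    apply le_antisymm
    · rintro _ ⟨y, rfl⟩
      rw [hT, hV]
      intro i j hij
      rw [linMat_free ι N hN, if_neg hij]
    · intro A hA
      obtain ⟨y, hy⟩ := hsurj A ((hV A).mp hA)
      exact ⟨y, by rw [hT, hy]⟩
  -- the pencil certificate `(W.comap T, k)` of price `n k + (dim V − dim W)`
  have hcert : RelCert n b N (n * k + (Module.finrank ℂ V - Module.finrank ℂ W)) := by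
    refine ⟨W.comap T, k, ?_, ?_⟩
    · intro x v hv p hp i j _ _
      rw [map_lineSubst_eq_add_smul N haff h0]
      have hvW : linMat N v ∈ W := by rw [← hT]; exact Submodule.mem_comap.mp hv
      exact hwin (linMat N x) (by rw [← hrange, ← hT]; exact LinearMap.mem_range_self T x) (linMat N v) hvW p hp i j
    · rw [codim_comap_eq T W (by rw [hrange]; exact hWV), hrange]
  exact two_mul_sq_le_of_relCert ι hιinj N hN hcert

/-- ★★★ **UPPER BOUND, SUBMODULE CURRENCY.**  For every order `k` the strictly upper triangular matrices `V` (`b ≤ n`) admit a window pair `(W, k)`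
of cost `≤ n·k + (k+1)·C(⌈b/(k+1)⌉, 2)` (the block certificate ✓ `relCert_free_blocks`, pushed forward along the linear-part map). -/
theorem exists_window_strictUpper_blocks (hbn : b ≤ n) (V : Submodule ℂ (Matrix (Fin b) (Fin b) ℂ))
    (hV : ∀ A : Matrix (Fin b) (Fin b) ℂ, A ∈ V ↔ ∀ i j, ¬ i < j → A i j = 0) (k : ℕ) :
    ∃ (W : Submodule ℂ (Matrix (Fin b) (Fin b) ℂ)) (k' : ℕ), W ≤ V ∧
      (∀ A ∈ V, ∀ w ∈ W, ∀ p : ℕ, p ≤ n - 1 → ∀ i j : Fin b,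
        ((((A.map (C : ℂ → MvPolynomial (Fin 1) ℂ) + (X 0 : MvPolynomial (Fin 1) ℂ) • w.map C) ^ p :
          Matrix (Fin b) (Fin b) (MvPolynomial (Fin 1) ℂ)) i j).totalDegree ≤ k')) ∧
      n * k' + (Module.finrank ℂ V - Module.finrank ℂ W) ≤ n * k + (k + 1) * Nat.choose ((b + k) / (k + 1)) 2 := by
  classical
  set ι : Fin b → Fin n := Fin.castLE hbn with hι
  have hιinj : Function.Injective ι := Fin.castLE_injective hbn
  set N : AffMat n b := Matrix.of fun i j => if i < j then X (ι i, ι j) else 0 with hNdef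
  have hN : ∀ i j, N i j = if i < j then X (ι i, ι j) else 0 := fun i j => rfl
  obtain ⟨h0, hsurj⟩ := free_std_spec hbn N hN
  have haff := isAffine_free ι N hN
  obtain ⟨T, hT⟩ := exists_linearMap_linMat N
  have hrange : LinearMap.range T = V := by
    apply le_antisymm
    · rintro _ ⟨y, rfl⟩
      rw [hT, hV]
      intro i j hij
      rw [linMat_free ι N hN, if_neg hij]
    · intro A hA
      obtain ⟨y, hy⟩ := hsurj A ((hV A).mp hA)
      exact ⟨y, by rw [hT, hy]⟩
  obtain ⟨K, k', hK, hprice⟩ := relCert_free_blocks ι hιinj N hN k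
  refine ⟨K.map T, k', by rw [← hrange]; exact LinearMap.map_le_range, ?_, ?_⟩
  · intro A hA w hw p hp i j
    obtain ⟨x, hx⟩ := hsurj A ((hV A).mp hA)
    obtain ⟨v, hvK, hv⟩ := Submodule.mem_map.mp hw
    rw [hT] at hv
    have := hK x v hvK p hp i j trivial trivial
    rwa [map_lineSubst_eq_add_smul N haff h0, hx, hv] at this
  · have h3 := codim_map_le_codim T K
    rw [hrange] at h3
    exact le_trans (Nat.add_le_add_left h3 _) hprice

end Summit.ValiantsHypothesis.ValiantsHypothesis.Theorems.GrenetZeon.FreeTriangularPrice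

end
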